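import Summits.KontsevichZagierPeriods.KontsevichZagierPeriods.Theses.LiouvilleUnfolding
import Literature.NumberTheory.Transcendental.KZLogCalculusProofs
import Literature.NumberTheory.Transcendental.KZIntervalPeriodProofs
import Literature.NumberTheory.Transcendental.SemialgebraicDerivativeProofs

/-!
# `LiouvilleUnfolding.UnfoldedLogStokes` (stmt-KontsevichZagierPeriods-2835) — negative side, kit

Witness toolkit for the negative knowledge about the crux `UnfoldedLogStokes` of route
KontsevichZagierPeriods/LiouvilleUnfolding (refuter, cdisprove; files `Negative/LoadBearing.lean`,
`Negative/LoadBearingII.lean`, `Negative/Strengthenings.lean`).  Everything lives in the smallest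
dimension `n = 0`: base `τ₀ = ℝ⁰`, bands = intervals `I lo hi` of the `t`-line written as `KZlog.band`
so that the crux's domain equations hold by `rfl`; honest representations `zeroRep = [D, 0]`,
`invRep = [D, 1/u]` (`D ⊆ [1,2]`, the unfolding of `log`), `r4inv = [[0,1], 1/(1+t)]`, with the value
facts that drive every refutation (`value_zeroRep`, `value_invRep_of_null`, `half_le_value_invRep`,
`half_le_value_r4inv`), soundness in the crux's four-term shape (`values_of_mem_relations`, from
`KZ.relations_le_ker_eval_holds`), semialgebraic steps (`sa_ite`, `step`), the honest data `Hcoord = t`,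
`Vlin = 1 + t`, `Vhalf = (1+t)/2`, and the boundary domains `Bdry V c = {1 ≤ u ≤ V(c)}` written exactly
as the crux writes `r₂.domain`, `r₃.domain`.  `Orig` is a verbatim copy of the crux
(`orig_iff : Orig ↔ UnfoldedLogStokes := Iff.rfl`); the variants of the other files edit one clause of it.
[Kontsevich–Zagier 2001, §1.2] [folklore]
-/

noncomputable section

open Set MeasureTheory MvPolynomial Filter Topology
open Literature.NumberTheory.Transcendental Literature.ModelTheory.ExponentialFields
open Literature.NumberTheory.Transcendental.SemialgebraicDerivative (sa_atom)
open Summit.KontsevichZagierPeriods.KontsevichZagierPeriods.Theses.LiouvilleUnfolding (UnfoldedLogStokes)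

namespace Summit.KontsevichZagierPeriods.LiouvilleUnfolding.UnfoldedLogStokesNegative


/-! ## §0 The crux restated (text-fidelity anchor for the variants below) -/

/-- Verbatim copy of the body of the route decl `LiouvilleUnfolding.UnfoldedLogStokes`; every
`…Without…` / strengthened variant below is obtained from THIS text by deleting or editing exactly
one clause, and `orig_iff` certifies the copy. -/
def Orig : Prop :=
  ∀ (n : ℕ) (τ : Set (Fin n → ℝ)) (a b : (Fin n → ℝ) → ℝ) (H H' V V' : (Fin (n + 1) → ℝ) → ℝ) (r₁ : Literature.NumberTheory.Transcendental.KZ.IntegralRep (n + 2)) (r₂ r₃ r₄ : Literature.NumberTheory.Transcendental.KZ.IntegralRep (n + 1)), Literature.ModelTheory.ExponentialFields.IsSemialgebraic ℚ τ →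
    Literature.NumberTheory.Transcendental.IsSemialgebraicFunOn ℚ τ a →
    Literature.NumberTheory.Transcendental.IsSemialgebraicFunOn ℚ τ b →
    (∀ x ∈ τ, a x ≤ b x) →
    r₄.domain = {z | (Fin.init z : Fin n → ℝ) ∈ τ ∧ a (Fin.init z) ≤ z (Fin.last n) ∧ z (Fin.last n) ≤ b (Fin.init z)} →
    Literature.NumberTheory.Transcendental.IsSemialgebraicFunOn ℚ r₄.domain H →
    Literature.NumberTheory.Transcendental.IsSemialgebraicFunOn ℚ r₄.domain V →
    (∀ z ∈ r₄.domain, 1 ≤ V z) →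
    (∀ x ∈ τ, ContinuousOn (fun t : ℝ => H (Fin.snoc x t)) (Set.Icc (a x) (b x)) ∧ ContinuousOn (fun t : ℝ => V (Fin.snoc x t)) (Set.Icc (a x) (b x))) →
    (∀ x ∈ τ, ∀ t ∈ Set.Ioo (a x) (b x), HasDerivAt (fun s : ℝ => H (Fin.snoc x s)) (H' (Fin.snoc x t)) t ∧ HasDerivAt (fun s : ℝ => V (Fin.snoc x s)) (V' (Fin.snoc x t)) t) →
    (∀ z ∈ r₄.domain, a (Fin.init z) < z (Fin.last n) → z (Fin.last n) < b (Fin.init z) → r₄.integrand z = H z * V' z / V z) →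
    r₁.domain = {w | (Fin.init w : Fin (n + 1) → ℝ) ∈ r₄.domain ∧ 1 ≤ w (Fin.last (n + 1)) ∧ w (Fin.last (n + 1)) ≤ V (Fin.init w)} →
    (∀ w ∈ r₁.domain, a (Fin.init (Fin.init w)) < Fin.init w (Fin.last n) → Fin.init w (Fin.last n) < b (Fin.init (Fin.init w)) → r₁.integrand w = H' (Fin.init w) / w (Fin.last (n + 1))) →
    r₂.domain = {z | (Fin.init z : Fin n → ℝ) ∈ τ ∧ 1 ≤ z (Fin.last n) ∧ z (Fin.last n) ≤ V (Fin.snoc (Fin.init z) (b (Fin.init z)))} →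
    (∀ z ∈ r₂.domain, r₂.integrand z = H (Fin.snoc (Fin.init z) (b (Fin.init z))) / z (Fin.last n)) →
    r₃.domain = {z | (Fin.init z : Fin n → ℝ) ∈ τ ∧ 1 ≤ z (Fin.last n) ∧ z (Fin.last n) ≤ V (Fin.snoc (Fin.init z) (a (Fin.init z)))} →
    (∀ z ∈ r₃.domain, r₃.integrand z = H (Fin.snoc (Fin.init z) (a (Fin.init z))) / z (Fin.last n)) →
    Literature.NumberTheory.Transcendental.KZ.of r₁ - Literature.NumberTheory.Transcendental.KZ.of r₂ + Literature.NumberTheory.Transcendental.KZ.of r₃ + Literature.NumberTheory.Transcendental.KZ.of r₄ ∈ Literature.NumberTheory.Transcendental.KZ.relations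

/-- The copy is the crux, definitionally. -/
theorem orig_iff : Orig ↔ UnfoldedLogStokes := Iff.rfl

/-! ## §1 Witness toolkit: honest one-variable representations over the one-point base

All counterexamples live in the smallest dimension `n = 0`: base `τ = ℝ⁰ = {pt}`, band `= [a, b]`
on the `t`-line, unfolded domains in the `(t, u)`-plane.  Soundness of the four moves
(`KZ.relations_le_ker_eval_holds`, PROVED in tree) is the only invariant used: a variant is refuted
by exhibiting honest representations satisfying its hypotheses whose signed values do not cancel. -/

/-- The one-point base `ℝ⁰`. -/
abbrev τ₀ : Set (Fin 0 → ℝ) := univ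

/-- The one-point base is semialgebraic. [folklore] -/
theorem sa_τ₀ : IsSemialgebraic ℚ τ₀ := isSemialgebraic_univ

section consts
variable {m : ℕ} {s : Set (Fin m → ℝ)}

/-- The constant `0` is a semialgebraic function. [folklore] -/
theorem sa_zero (hs : IsSemialgebraic ℚ s) : IsSemialgebraicFunOn ℚ s (fun _ => (0 : ℝ)) := by
  simpa using isSemialgebraicFunOn_ratCast hs 0

/-- The constant `1` is a semialgebraic function. [folklore] -/
theorem sa_one (hs : IsSemialgebraic ℚ s) : IsSemialgebraicFunOn ℚ s (fun _ => (1 : ℝ)) := by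
  simpa using isSemialgebraicFunOn_ratCast hs 1

/-- The constant `2` is a semialgebraic function. [folklore] -/
theorem sa_two (hs : IsSemialgebraic ℚ s) : IsSemialgebraicFunOn ℚ s (fun _ => (2 : ℝ)) := by
  simpa using isSemialgebraicFunOn_ratCast hs 2

end consts

/-- The interval `[lo, hi]` of the `t`-line (or `u`-line), written as a band over `ℝ⁰` so that it
matches the crux's domain equations DEFINITIONALLY. -/
def I (lo hi : ℝ) : Set (Fin 1 → ℝ) := KZlog.band τ₀ (fun _ => lo) (fun _ => hi)

/-- Membership in the interval `I lo hi`. [folklore] -/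
theorem mem_I {lo hi : ℝ} {z : Fin 1 → ℝ} :
    z ∈ I lo hi ↔ lo ≤ z 0 ∧ z 0 ≤ hi := by
  simp [I, KZlog.mem_band]

/-- `I lo hi` is the order interval `Icc` of `ℝ¹`. [folklore] -/
theorem I_eq_Icc (lo hi : ℝ) : I lo hi = Icc (fun _ => lo) (fun _ => hi) := by
  ext z
  simp [mem_I, Pi.le_def, Fin.forall_fin_one]

/-- `I lo hi` is compact. [folklore] -/
theorem isCompact_I (lo hi : ℝ) : IsCompact (I lo hi) := by
  rw [I_eq_Icc]; exact isCompact_Icc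

/-- `I lo hi` is measurable. [folklore] -/
theorem measurableSet_I (lo hi : ℝ) : MeasurableSet (I lo hi) := by
  rw [I_eq_Icc]; exact measurableSet_Icc

/-- The length of `I lo hi` is `hi - lo`. [folklore] -/
theorem volume_real_I {lo hi : ℝ} (h : lo ≤ hi) : volume.real (I lo hi) = hi - lo := by
  rw [I_eq_Icc, measureReal_def, Real.volume_Icc_pi_toReal (fun _ => h)]
  simp

/-- A degenerate interval is Lebesgue-null. -/
theorem volume_I_eq_zero {lo hi : ℝ} (h : hi ≤ lo) : volume (I lo hi) = 0 :=
  measure_mono_null (fun z hz => by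
    have hz' := mem_I.1 hz
    show z (Fin.last 0) = lo
    exact le_antisymm (hz'.2.trans h) hz'.1) (KZ.volume_setOf_last_eq_zero lo)

/-- `I lo hi` is semialgebraic for semialgebraic (e.g. rational) endpoints. [folklore] -/
theorem sa_I {lo hi : ℝ} (hlo : IsSemialgebraicFunOn ℚ τ₀ (fun _ => lo))
    (hhi : IsSemialgebraicFunOn ℚ τ₀ (fun _ => hi)) : IsSemialgebraic ℚ (I lo hi) :=
  KZlog.isSemialgebraic_band hlo hhi

/-- `[0,1]` is semialgebraic. [folklore] -/
theorem sa_I01 : IsSemialgebraic ℚ (I 0 1) := sa_I (sa_zero sa_τ₀) (sa_one sa_τ₀)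
/-- `[1,2]` is semialgebraic. [folklore] -/
theorem sa_I12 : IsSemialgebraic ℚ (I 1 2) := sa_I (sa_one sa_τ₀) (sa_two sa_τ₀)
/-- The empty interval `[1,0]` is semialgebraic. [folklore] -/
theorem sa_I10 : IsSemialgebraic ℚ (I 1 0) := sa_I (sa_one sa_τ₀) (sa_zero sa_τ₀)
/-- The point `[1,1]` is semialgebraic. [folklore] -/
theorem sa_I11 : IsSemialgebraic ℚ (I 1 1) := sa_I (sa_one sa_τ₀) (sa_one sa_τ₀)

/-- `[D, 0]`: the honest representation with zero integrand. -/
def zeroRep {m : ℕ} (D : Set (Fin m → ℝ)) (hD : IsSemialgebraic ℚ D) : KZ.IntegralRep m :=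
  ⟨D, fun _ => 0, hD, sa_zero hD, integrableOn_zero⟩

/-- Domain of `zeroRep`. [folklore] -/
@[simp] theorem zeroRep_domain {m : ℕ} (D : Set (Fin m → ℝ)) (hD : IsSemialgebraic ℚ D) :
    (zeroRep D hD).domain = D := rfl

/-- Integrand of `zeroRep`. [folklore] -/
@[simp] theorem zeroRep_integrand {m : ℕ} (D : Set (Fin m → ℝ)) (hD : IsSemialgebraic ℚ D) :
    (zeroRep D hD).integrand = fun _ => 0 := rfl

/-- `[D, 0]` has value `0`. [folklore] -/
@[simp] theorem value_zeroRep {m : ℕ} (D : Set (Fin m → ℝ)) (hD : IsSemialgebraic ℚ D) :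
    (zeroRep D hD).value = 0 := by
  simp [KZ.IntegralRep.value]

/-- `[D, 1/u]` for `D ⊆ [1, 2]` on the `u`-line: the unfolding of `log`. -/
def invRep (D : Set (Fin 1 → ℝ)) (hD : IsSemialgebraic ℚ D) (hsub : D ⊆ I 1 2) :
    KZ.IntegralRep 1 where
  domain := D
  integrand := fun z => 1 / z 0
  isSemialgebraic_domain := hD
  isSemialgebraicFunOn_integrand := by
    have h := isSemialgebraicFunOn_aeval_div_aeval hD (1 : MvPolynomial (Fin 1) ℚ) (X 0)
      (fun z hz => by
        have h1 := (mem_I.1 (hsub hz)).1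
        simp only [aeval_X]
        exact ne_of_gt (by linarith))
    refine h.congr fun z _ => ?_
    simp
  integrableOn := by
    refine (ContinuousOn.integrableOn_compact (isCompact_I 1 2) ?_).mono_set hsub
    exact continuousOn_const.div ((continuous_apply _).continuousOn)
      (fun z hz => ne_of_gt (lt_of_lt_of_le one_pos (mem_I.1 hz).1))

/-- Domain of `invRep`. [folklore] -/
@[simp] theorem invRep_domain (D : Set (Fin 1 → ℝ)) (hD : IsSemialgebraic ℚ D) (hsub : D ⊆ I 1 2) :
    (invRep D hD hsub).domain = D := rfl

/-- Integrand of `invRep`. [folklore] -/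
@[simp] theorem invRep_integrand (D : Set (Fin 1 → ℝ)) (hD : IsSemialgebraic ℚ D)
    (hsub : D ⊆ I 1 2) : (invRep D hD hsub).integrand = fun z => 1 / z 0 := rfl

/-- `[D, 1/u]` over a null `D` has value `0`. [folklore] -/
theorem value_invRep_of_null {D : Set (Fin 1 → ℝ)} (hD : IsSemialgebraic ℚ D) (hsub : D ⊆ I 1 2)
    (h0 : volume D = 0) : (invRep D hD hsub).value = 0 :=
  setIntegral_measure_zero _ h0

/-- `∫₁² du/u ≥ 1/2` (it is `log 2`; a lower bound is all that is needed). -/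
theorem half_le_value_invRep {D : Set (Fin 1 → ℝ)} (hD : IsSemialgebraic ℚ D) (hsub : D ⊆ I 1 2)
    (hDeq : D = I 1 2) : 1 / 2 ≤ (invRep D hD hsub).value := by
  subst hDeq
  have hf : ∀ z ∈ I 1 2, (1 / 2 : ℝ) ≤ 1 / z 0 := fun z hz => by
    obtain ⟨h1, h2⟩ := mem_I.1 hz
    exact one_div_le_one_div_of_le (by linarith) h2
  have h := setIntegral_ge_of_const_le (μ := volume) (measurableSet_I 1 2)
    (isCompact_I 1 2).measure_lt_top.ne hf (invRep (I 1 2) hD hsub).integrableOn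
  rw [volume_real_I one_le_two, smul_eq_mul] at h
  show (1 / 2 : ℝ) ≤ ∫ x in I 1 2, 1 / x 0
  linarith

/-- `[[0,1], 1/(1+t)]`: the bulk term `H V'/V` for `H = 1`, `V = 1 + t` (and for `V = (1+t)/2`). -/
def r4inv : KZ.IntegralRep 1 where
  domain := I 0 1
  integrand := fun z => 1 / (1 + z 0)
  isSemialgebraic_domain := sa_I01
  isSemialgebraicFunOn_integrand := by
    have h := isSemialgebraicFunOn_aeval_div_aeval sa_I01 (1 : MvPolynomial (Fin 1) ℚ)
      (1 + X 0)
      (fun z hz => by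
        have h1 := (mem_I.1 hz).1
        simp only [map_add, map_one, aeval_X]
        exact ne_of_gt (by linarith))
    refine h.congr fun z _ => ?_
    simp
  integrableOn := by
    refine ContinuousOn.integrableOn_compact (isCompact_I 0 1) ?_
    exact continuousOn_const.div (continuousOn_const.add (continuous_apply _).continuousOn)
      (fun z hz => ne_of_gt (by have h1 := (mem_I.1 hz).1; linarith))

/-- Domain of `r4inv`. [folklore] -/
@[simp] theorem r4inv_domain : r4inv.domain = I 0 1 := rfl
/-- Integrand of `r4inv`. [folklore] -/
@[simp] theorem r4inv_integrand : r4inv.integrand = fun z => 1 / (1 + z 0) := rfl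

/-- `∫₀¹ dt/(1+t) ≥ 1/2` (it is `log 2`). -/
theorem half_le_value_r4inv : 1 / 2 ≤ r4inv.value := by
  have hf : ∀ z ∈ I 0 1, (1 / 2 : ℝ) ≤ 1 / (1 + z 0) := fun z hz => by
    obtain ⟨h1, h2⟩ := mem_I.1 hz
    exact one_div_le_one_div_of_le (by linarith) (by linarith)
  have h := setIntegral_ge_of_const_le (μ := volume) (measurableSet_I 0 1)
    (isCompact_I 0 1).measure_lt_top.ne hf r4inv.integrableOn
  rw [volume_real_I zero_le_one, smul_eq_mul] at h
  show (1 / 2 : ℝ) ≤ ∫ x in I 0 1, 1 / (1 + x 0)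
  linarith

/-- Soundness, specialised to the crux's four-term shape. -/
theorem values_of_mem_relations {n : ℕ} (r₁ : KZ.IntegralRep (n + 2))
    (r₂ r₃ r₄ : KZ.IntegralRep (n + 1))
    (h : KZ.of r₁ - KZ.of r₂ + KZ.of r₃ + KZ.of r₄ ∈ KZ.relations) :
    r₁.value - r₂.value + r₃.value + r₄.value = 0 := by
  have h' := KZ.relations_le_ker_eval_holds h
  simpa [AddMonoidHom.mem_ker, map_add, map_sub, KZ.eval_of] using h'

/-! ### The honest data used by the witnesses -/

/-- On `ℝ¹`, `Fin.snoc` over the empty tuple is the constant tuple (simp helper: Mathlib's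
`Fin.snoc_last` is keyed on `Fin.last 0`, which `simp` normalises to `0`). -/
@[simp] theorem snoc_fin0 (x : Fin 0 → ℝ) (c : ℝ) : (Fin.snoc x c : Fin 1 → ℝ) 0 = c := rfl

/-- `H = t` (the band coordinate). -/
def Hcoord : (Fin 1 → ℝ) → ℝ := fun z => z 0
/-- `V = 1 + t`. -/
def Vlin : (Fin 1 → ℝ) → ℝ := fun z => 1 + z 0
/-- `V = (1 + t)/2` (positive, but `< 1` on `[0, 1)`). -/
def Vhalf : (Fin 1 → ℝ) → ℝ := fun z => (1 + z 0) / 2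
/-- The cut `{t < 1}` of the `t`-line. -/
def Cut : Set (Fin 1 → ℝ) := {z | z 0 < 1}
open Classical in
/-- The semialgebraic step `t ↦ if t < 1 then c₁ else c₂`. -/
def step (c₁ c₂ : ℝ) : (Fin 1 → ℝ) → ℝ := fun z => if z ∈ Cut then c₁ else c₂

/-- `Hcoord` evaluated. [folklore] -/
@[simp] theorem Hcoord_apply (z : Fin 1 → ℝ) : Hcoord z = z 0 := rfl
/-- `Vlin` evaluated. [folklore] -/
@[simp] theorem Vlin_apply (z : Fin 1 → ℝ) : Vlin z = 1 + z 0 := rfl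
/-- `Vhalf` evaluated. [folklore] -/
@[simp] theorem Vhalf_apply (z : Fin 1 → ℝ) : Vhalf z = (1 + z 0) / 2 := rfl
/-- Membership in the cut `{t < 1}`. [folklore] -/
theorem mem_Cut {z : Fin 1 → ℝ} : z ∈ Cut ↔ z 0 < 1 := Iff.rfl
/-- The step below the jump. [folklore] -/
theorem step_of_lt {c₁ c₂ : ℝ} {z : Fin 1 → ℝ} (h : z 0 < 1) : step c₁ c₂ z = c₁ := by
  unfold step; exact if_pos h
/-- The step at and above the jump. [folklore] -/
theorem step_of_not_lt {c₁ c₂ : ℝ} {z : Fin 1 → ℝ} (h : ¬ z 0 < 1) :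
    step c₁ c₂ z = c₂ := by
  unfold step; exact if_neg h

/-- `H = t` is semialgebraic. [folklore] -/
theorem sa_Hcoord {s : Set (Fin 1 → ℝ)} (hs : IsSemialgebraic ℚ s) : IsSemialgebraicFunOn ℚ s Hcoord :=
  isSemialgebraicFunOn_apply hs 0

/-- `V = 1 + t` is semialgebraic. [folklore] -/
theorem sa_Vlin {s : Set (Fin 1 → ℝ)} (hs : IsSemialgebraic ℚ s) : IsSemialgebraicFunOn ℚ s Vlin := by
  refine (isSemialgebraicFunOn_aeval hs (1 + X 0 : MvPolynomial (Fin 1) ℚ)).congr fun z _ => ?_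
  simp

/-- `V = (1+t)/2` is semialgebraic. [folklore] -/
theorem sa_Vhalf {s : Set (Fin 1 → ℝ)} (hs : IsSemialgebraic ℚ s) :
    IsSemialgebraicFunOn ℚ s Vhalf := by
  have h := isSemialgebraicFunOn_aeval_div_aeval hs (1 + X 0 : MvPolynomial (Fin 1) ℚ)
    (C 2) (fun z _ => by simp)
  refine h.congr fun z _ => ?_
  simp [Vhalf]

/-- The cut `{t < 1}` is semialgebraic. [folklore] -/
theorem sa_Cut : IsSemialgebraic ℚ Cut :=
  sa_atom (X 0) (C 1) (fun z => by simp)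

/-- Piecewise (`if … ∈ c then f else g`) of semialgebraic functions along a semialgebraic cut is
semialgebraic (union of the two half-graphs). -/
theorem sa_ite {m : ℕ} {s c : Set (Fin m → ℝ)} {f g : (Fin m → ℝ) → ℝ} [DecidablePred (· ∈ c)]
    (hc : IsSemialgebraic ℚ c) (hf : IsSemialgebraicFunOn ℚ s f) (hg : IsSemialgebraicFunOn ℚ s g) :
    IsSemialgebraicFunOn ℚ s (fun z => if z ∈ c then f z else g z) := by
  rw [isSemialgebraicFunOn_iff] at hf hg ⊢
  have hc' : IsSemialgebraic ℚ {w : Fin (m + 1) → ℝ | Fin.init w ∈ c} := hc.setOf_init_mem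
  convert (hf.inter hc').union (hg.inter hc'.compl) using 1
  ext w
  simp only [mem_setOf_eq, mem_union, mem_inter_iff, mem_compl_iff]
  by_cases h : Fin.init w ∈ c
  · simp [h]
  · simp [h]

/-- Steps with semialgebraic (e.g. rational) values are semialgebraic. [folklore] -/
theorem sa_step {s : Set (Fin 1 → ℝ)} {c₁ c₂ : ℝ}
    (h₁ : IsSemialgebraicFunOn ℚ s (fun _ => c₁)) (h₂ : IsSemialgebraicFunOn ℚ s (fun _ => c₂)) :
    IsSemialgebraicFunOn ℚ s (step c₁ c₂) := by
  classical
  unfold step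
  convert sa_ite sa_Cut h₁ h₂ using 3

/-- The unfolded bulk domain `{(t, u) | t ∈ D, 1 ≤ u ≤ V t}` in the `(t,u)`-plane. -/
def r1zero (D : Set (Fin 1 → ℝ)) (hD : IsSemialgebraic ℚ D) (V : (Fin 1 → ℝ) → ℝ)
    (hV : IsSemialgebraicFunOn ℚ D V) : KZ.IntegralRep 2 :=
  zeroRep (KZlog.band D (fun _ => 1) V) (KZlog.isSemialgebraic_band (sa_one hD) hV)

/-- The boundary domain `{1 ≤ u ≤ V(·, c)}` over `ℝ⁰`, written EXACTLY as the crux writes the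
domains of `r₂` (`c = b`) and `r₃` (`c = a`), so that the domain equations hold by `rfl`. -/
def Bdry (V : (Fin 1 → ℝ) → ℝ) (c : ℝ) : Set (Fin 1 → ℝ) :=
  KZlog.band τ₀ (fun _ => 1) (fun x => V (Fin.snoc x ((fun _ : Fin 0 → ℝ => c) x)))

/-- The boundary domain is the interval `[1, V(c)]`. [folklore] -/
theorem Bdry_eq_I {V : (Fin 1 → ℝ) → ℝ} {c v : ℝ} (hv : ∀ x : Fin 0 → ℝ, V (Fin.snoc x c) = v) :
    Bdry V c = I 1 v := by
  ext z
  simp [Bdry, I, KZlog.mem_band, hv]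

/-- The boundary domain is semialgebraic when `V(c)` is rational. [folklore] -/
theorem sa_Bdry {V : (Fin 1 → ℝ) → ℝ} {c v : ℝ} (hv : ∀ x : Fin 0 → ℝ, V (Fin.snoc x c) = v)
    (hvs : IsSemialgebraicFunOn ℚ τ₀ (fun _ => v)) : IsSemialgebraic ℚ (Bdry V c) := by
  rw [Bdry_eq_I hv]; exact sa_I (sa_one sa_τ₀) hvs

/-- The boundary domain lies in `[1,2]` when `V(c) ≤ 2`. [folklore] -/
theorem Bdry_subset_I12 {V : (Fin 1 → ℝ) → ℝ} {c v : ℝ} (hv : ∀ x : Fin 0 → ℝ, V (Fin.snoc x c) = v)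
    (h2 : v ≤ 2) : Bdry V c ⊆ I 1 2 := by
  rw [Bdry_eq_I hv]
  intro z hz
  obtain ⟨h1, h3⟩ := mem_I.1 hz
  exact mem_I.2 ⟨h1, h3.trans h2⟩


end Summit.KontsevichZagierPeriods.LiouvilleUnfolding.UnfoldedLogStokesNegative
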